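/-
certnum — RQ-016 SMIB post-fault kernel replay (client pub/gridfusion, LADDER-GRIDFUSION G1-cct): KERNEL REPLAY, stage checks 22–23 of 39 (kernel lane).  NOT a certification of any client number.
-/
import Literature.Computation.Certificates.CapOdeDoubletonReplayPostFaultData
import HarnessLib

/-!
# RQ-016 SMIB post-fault kernel replay (client pub/gridfusion, LADDER-GRIDFUSION G1-cct) — stage checks 22–23 of 39

One theorem per stage `j`: `EDStage.stepCheck` of stage `j` against node `j + 1` (node 39 = the final node) —
the state and variational high-order enclosure tests over `W_j`, `W_j` non-degenerate, centre `∈ W_j`, the point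
certificate of the centre, hull `⊆ W_j`, the exact inverse `Q′B′ = 1`, the `C¹`-Lohner rearrangement box `⊆ [R′]` —
nine conjuncts, one `decide +kernel` each (≈ 75–135 s of kernel time per stage).  Stated literally in the hypothesis
shape of `EDChainCert.check_of_forall` so MAIN assembles them by `exact`.  Data: `CapOdeDoubletonReplayPostFaultData.lean`.  Kernel replay of a
cap-ode-cert/2 instance; NOT a certification of any client number.
-/

open Set NonemptyInterval Matrix
open scoped Pointwise
open Literature.Analysis.ValidatedNumerics Literature.Analysis.ValidatedNumerics.ITaylor
open Literature.Analysis.ODE Literature.Analysis.ODE.FExpr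

namespace Literature.Computation.Certificates.CapOdeDoubletonReplay

set_option maxHeartbeats 0 in
/-- Stage 22 of 39 checks against node 23 (`[τ_22, τ_23] = [9009/32768, 18837/65536]`). [cite: MrozekZgliczynski2000, Lemma 8.5] -/
theorem smibK13PostFault_stage22 :
    (smibK13PostFaultChain.stageAt 22).stepCheck smibK13PostFaultChain.field smibK13PostFaultChain.cfg smibK13PostFaultChain.r0 (smibK13PostFaultChain.nodeAt (22 + 1)) = true := by
  simp only [EDStage.stepCheck, EMVStepCert.check, EVarStepCert.check, Bool.and_eq_true]
  exact ⟨⟨⟨⟨⟨⟨⟨⟨by decide +kernel, by decide +kernel⟩, by decide +kernel⟩, by decide +kernel⟩, by decide +kernel⟩, by decide +kernel⟩,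
    by decide +kernel⟩, by decide +kernel⟩, by decide +kernel⟩

set_option maxHeartbeats 0 in
/-- Stage 23 of 39 checks against node 24 (`[τ_23, τ_24] = [18837/65536, 2457/8192]`). [cite: MrozekZgliczynski2000, Lemma 8.5] -/
theorem smibK13PostFault_stage23 :
    (smibK13PostFaultChain.stageAt 23).stepCheck smibK13PostFaultChain.field smibK13PostFaultChain.cfg smibK13PostFaultChain.r0 (smibK13PostFaultChain.nodeAt (23 + 1)) = true := by
  simp only [EDStage.stepCheck, EMVStepCert.check, EVarStepCert.check, Bool.and_eq_true]
  exact ⟨⟨⟨⟨⟨⟨⟨⟨by decide +kernel, by decide +kernel⟩, by decide +kernel⟩, by decide +kernel⟩, by decide +kernel⟩, by decide +kernel⟩,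
    by decide +kernel⟩, by decide +kernel⟩, by decide +kernel⟩

end Literature.Computation.Certificates.CapOdeDoubletonReplay
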